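import Summits.QuantumFields.YangMills.Theorems.BalabanUVNodesN22KernelFadingOfStepRateTwoConstants
import Summits.QuantumFields.YangMills.Theorems.BalabanUVNodesN22KernelFadingOfStepRateModel

/-!
# BalabanUVNodes ∕ node N22 = NE9 — A6 FOR THE ANALYTIC KERNEL-FADING ROAD: a NON-DEGENERATE model inhabitant of ALL displayed binders of
# `…N22KernelFadingOfStepRateTwoConstants` §1 (node N18's kernel step rate, uniform kernel decay, (1.21) existence AND the WINDOWED COUPLING-HOLOMORPHY
# datum) through def-B's actual (1.20)–(1.22) machinery — dag-n18-w2's mixed two-bond family with the FADING amplitude law — at which §1 FIRES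
# (Track A, DAG node N22 = NE9; cluster K4 «SpineRates»; WIDTH SEAT `pub-ymgap-dag-n22-w1`, harness re-seat g4)

Cell `pub-ymgap`, HUMAN RULING D-0062 (Track A) ∕ D-0149; `--kind proof --supports stmt-QuantumFields-27366 --as helper` (K3⁸ `SpineGivenEndpointR13SepCoPHV`, KEY MAP v2),
COUNT-NEUTRAL.  THEOREMS ONLY (0 `def`, 0 `sorry`, standard axioms).  Imports this seat's C2 `…N22KernelFadingOfStepRateTwoConstants` (p624657) and dag-n18-w2's
`…N22KernelFadingOfStepRateModel` (dag-n22-w2 g5: `decayBound_EA_cross_of_bound`, `wt_pos`; through it dag-n18-w2's `…N18RunningBetaLettersModelNodes`: the mixed two-bond family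
`crossTermFamily F a e`, its closed-form `polWindow ∕ polLimit ∕ kernelA`, the fading law `fadingLaw ω` and its kernel letters `kernelStepRate_fadingCross` ∕ `polLimitsExist_cross` ∕
`ne9_EA_fadingCross`, `not_boxwiseConstant_fadingLaw`, and dag-n18-w2 g6's `fadingAmp` API) BY NAME.  Disjoint THEOREMS from dag-n22-w2 g5's file (the SECOND-DIFFERENCE road's
inhabitant at the quadratic law; pub-ymgap INBOX l.35928) — this is the HOLOMORPHY road's inhabitant at the linear fading law.

WHY.  C2's §1 `ne9_and_fadingMemory_EA_of_kernelStepRate_windowedHolo` DISPLAYS four inputs; its §3 rider inhabits them only DEGENERATELY (zero probe chart, all kernels `0`).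
A referee's A6 asks for a NON-degenerate joint inhabitant through the actual kernel machinery (`Node00/BetaOfRecord.polWindow` — the normalised trace of the field Hessian at
`B = 0` — and its (1.21) limits).  dag-n18-w2's two-bond family with amplitude law `a` has ITS windowed kernels in CLOSED FORM (`polWindow_crossTermFamily`: `a k v` times a
`K`-dependent indicator shape, eventually the closed-form kernel `crossKernel (a k v) e`); with the FADING law `a k v = Σ_{i≤k} ω^{k+1−i}v_i` the windowed section along a
one-coupling update `t ↦ Π^{(K)}_{k+1}(h|h_m:=t; z)` is AFFINE in `t` — an ENTIRE function with an explicit bound on any ball — so C2's windowed coupling-holomorphy datum holds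
ON THE NOSE, uniformly in `t` inside one eventual set (the three window separations do not read the history), next to N18's step rate (rate `θ = ω`), the uniform decay and
(1.21) existence.  C2 §1 then FIRES at every rate `ω^{1−s}`, while the model's TRUE moduli are `wt κ e·ω^{k−i}` (rate `ω`): the road brackets the truth from above, as the
rate certificate `…N22KnitRoadRatesSharpTwoConstants` says it must.

WHAT (all [folklore]; MODEL level).
* §1 `fadingAmp_histPrefix_update` (slope `ω^{k+1−m}` in the updated coupling), `crossKernel_eq_mul_one` (linearity in the amplitude).
* §2 `polWindow_update_eventually` (closed form with `∀ t` INSIDE the eventual set), ★★ `windowedCouplingHolo_fadingCross` — C2's binder `hA` at the model: eventually in `K`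
  the section is the restriction of the entire `τ ↦ (A₀ + ω^{k+1−m}(τ − h_m))·crossKernel 1 e μν z`, bounded on `‖τ‖ < |γ|+r+1 ⊇` the closed `r`-discs about `]0,γ]` by
  `(|γ|ω∕(1−ω) + |γ| + |γ|+r+1)·wt κ e·e^{−κ|z|₁}`.
* §3 `decayBound_EA_fadingCross` (`DecayBound (EA …) (Window γ) (|γ|ω∕(1−ω)·wt κ e) κ`, dag-n22-w2's `decayBound_EA_cross_of_bound` BY NAME), ★★★ `ne9_and_fadingMemory_EA_fadingCross` (ALL FOUR inputs hold and C2 §1 FIRES: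
  `∃ C₉, NE9 (EA …) (Window γ) κ (C₉(ω^{1−s})^{k−i}) ∧ FadingMemory C₉ ω^{1−s} _`, every `s ∈ ]0,1[`, `0 < ω < 1`, `γ, r > 0`, any `κ`, any `e`),
  `fadingCross_nondegenerate_and_trueRate` (`¬ BoxwiseConstant γ (fadingLaw ω)` ∧ NE9 with the TRUE moduli `wt κ e·ω^{k−i}`, dag-n18-w2 BY NAME).

HONEST FRAMING.  A MODEL-LEVEL A6 witness (a scalar two-bond term family in the identity chart — NOT NODE 00's merged term family, NOT print's `su(N) ↪ M_N(ℂ)` chart; nothing of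
Bałaban's is met or asserted); it certifies that C2 §1's binder shapes are jointly satisfiable by objects built with def-B's `polWindow ∕ polLimit ∕ kernelA`, non-degenerately.
Count-neutral; N22 NOT discharged (typed 28∕28 · discharged 5∕27 UNMOVED — the chair's single count line is the only count); K3⁸ OPEN, NOT claimed, skeleton untouched;
one finite four-torus programme at fixed ε — R4 closes the CONDITIONAL rung `BalabanLadder.UV` only; NOT infinite volume, NOT OS on ℝ⁴, NOT a mass gap, NOT Clay.

References (TYPES only): [I] = [Balaban1987RG1] T. Bałaban, Commun. Math. Phys. **109** (1987) 249–301 — Thm 1 p. 259, (1.18) p. 263, (1.20)–(1.22) p. 264, (5.10) p. 293;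
[II] = [Balaban1988RG2Cluster] Commun. Math. Phys. **116** (1988) 1–22 — (2.13) p. 14 (the terms the model caricatures).
-/

noncomputable section

open Filter Topology Set Metric
open scoped BigOperators

namespace YMDAG.N22.KernelFadingTwoConstants.Model

open Literature.MathematicalPhysics.QuantumFieldTheory.Balaban1983to89
open Literature.MathematicalPhysics.QuantumFieldTheory.Balaban1983to89.T4Continuum (T4Family)
open Literature.MathematicalPhysics.QuantumFieldTheory.Balaban1983to89.T4OutputRate (Window NE9 FadingMemory DecayBound)
open Literature.MathematicalPhysics.QuantumFieldTheory.Balaban1983to89.FlowStep (Box HBeta)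
open Literature.MathematicalPhysics.QuantumFieldTheory.Balaban1983to89.Node00 (TermFamily1 siteOfInt polWindow polLimit PolLimitExists)
open Literature.MathematicalPhysics.QuantumFieldTheory.Balaban1983to89.Node00.U3OfKernels (carriers histPrefix histPrefix_apply kernelA EA EA_apply)
open Literature.MathematicalPhysics.QuantumFieldTheory.Balaban1983to89.Node00.U3KernelLetters (KernelStepRate)
open Literature.MathematicalPhysics.QuantumFieldTheory.Balaban1983to89.B12Sec2to5 (l1)
open YMDAG.N18.FiniteVolumeLettersModel (fadingAmp fadingAmp_sub abs_fadingAmp_le histPrefix_mem_box)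
open YMDAG.N18.RunningBetaLettersModel (crossTermFamily crossKernel polWindow_crossTermFamily siteOfInt_eventually_eq_iff kernelA_crossTermFamily
  abs_crossKernel_le wt wt_nonneg fadingLaw fadingLaw_apply kernelStepRate_fadingCross polLimitsExist_cross ne9_EA_fadingCross crossLetters_moduli
  not_boxwiseConstant_fadingLaw)
open YMDAG.N22.KernelFading (update_mem_window)
open YMDAG.N22.KernelFading.Model (decayBound_EA_cross_of_bound wt_pos)

variable (F : T4Family)

/-! ## §1 The fading amplitude along a one-coupling update is AFFINE in the updated coupling -/

/-- Updating the young coupling `m ≤ k` to `t` shifts the fading amplitude by `ω^{k+1−m}·(t − h_m)`. [folklore] -/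
theorem fadingAmp_histPrefix_update (ω : ℝ) (h : ℕ → ℝ) {k m : ℕ} (hm : m < k + 1) (t : ℝ) :
    fadingAmp ω k (histPrefix (Function.update h m t) k) = fadingAmp ω k (histPrefix h k) + ω ^ (k + 1 - m) * (t - h m) := by
  have hsub := fadingAmp_sub ω k (histPrefix (Function.update h m t) k) (histPrefix h k)
  rw [Finset.sum_eq_single ⟨m, hm⟩] at hsub
  · simp only [histPrefix_apply, Function.update_self] at hsub
    linarith
  · intro i _ hi
    have hne : (i : ℕ) ≠ m := fun hh => hi (Fin.ext hh)
    simp only [histPrefix_apply, Function.update_of_ne hne, sub_self, mul_zero]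
  · intro hh; exact absurd (Finset.mem_univ _) hh

/-- The closed-form kernel is LINEAR in its amplitude: `crossKernel c e = c · crossKernel 1 e` entrywise. [folklore] -/
theorem crossKernel_eq_mul_one (c : ℝ) (e : Fin 4 → ℤ) (μ ν : Fin 4) (z : Fin 4 → ℤ) :
    crossKernel c e μ ν z = c * crossKernel 1 e μ ν z := by
  simp only [crossKernel, one_mul]

/-! ## §2 THE WINDOWED COUPLING-HOLOMORPHY DATUM AT THE FADING TWO-BOND MODEL — non-degenerately -/

/-- **EVENTUALLY IN THE VOLUME, UNIFORMLY IN THE UPDATED COUPLING, the windowed kernel of the fading two-bond family along a one-coupling update is the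
closed-form kernel at the (affine) updated amplitude** — dag-n18-w2's `polWindow_crossTermFamily_eventually` with the `∀ t` INSIDE the eventual set (the three window
separations do not read the history). [folklore] -/
theorem polWindow_update_eventually (ω : ℝ) (e : Fin 4 → ℤ) (h : ℕ → ℝ) (k m : ℕ) (μ ν : Fin 4) (z : Fin 4 → ℤ) :
    ∀ᶠ K in atTop, ∀ t : ℝ,
      polWindow F K (k + 1) (crossTermFamily F (fadingLaw ω) e k (histPrefix (Function.update h m t) k) K) (ContinuousLinearMap.id ℝ ℝ)
          (Module.Basis.singleton Unit ℝ) μ ν z =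
        crossKernel (fadingAmp ω k (histPrefix (Function.update h m t) k)) e μ ν z := by
  have h4 : ((0 : Fin 4 → ℤ) = e) ↔ (e = 0) := eq_comm
  filter_upwards [siteOfInt_eventually_eq_iff F (k + 1) z e, siteOfInt_eventually_eq_iff F (k + 1) z 0,
    siteOfInt_eventually_eq_iff F (k + 1) 0 e] with K h1 h2 h3
  intro t
  rw [polWindow_crossTermFamily, fadingLaw_apply]
  unfold crossKernel
  simp only [h1, h2, h3, h4]

/-- ★★ **THE WINDOWED COUPLING-HOLOMORPHY DATUM `hA` OF `…KernelFadingOfStepRateTwoConstants` §1 HOLDS AT THE FADING TWO-BOND MODEL, NON-DEGENERATELY**: for every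
window history `h`, level `k`, entry `(μν, z)`, young coupling `m ≤ k` and margin `r ≥ 0`, EVENTUALLY IN `K` the windowed section `t ↦ Π^{(K)}_{k+1}(h|h_m:=t; z)` IS
the restriction of the ENTIRE affine function `τ ↦ (A₀ + ω^{k+1−m}(τ − h_m))·crossKernel 1 e μν z` (`A₀ = fadingAmp ω k h_{≤k}`), bounded on the ball `‖τ‖ < |γ|+r+1` —
which contains the closed `r`-discs about `]0, γ]` — by `(|γ|ω∕(1−ω) + |γ| + (|γ|+r+1))·wt κ e·e^{−κ|z|₁}`.  The section genuinely READS the coupling `m` (slope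
`ω^{k+1−m}·crossKernel 1 e μν z`). [folklore] -/
theorem windowedCouplingHolo_fadingCross {ω γ : ℝ} (hω0 : 0 ≤ ω) (hω1 : ω < 1) (e : Fin 4 → ℤ) (κ : ℝ) {r : ℝ} (hr : 0 ≤ r)
    {h : ℕ → ℝ} (hh : h ∈ Window γ) (k : ℕ) (μ ν : Fin 4) (z : Fin 4 → ℤ) {m : ℕ} (hm : m < k + 1) :
    ∀ᶠ K in atTop, ∃ (Fc : ℂ → ℂ) (D : Set ℂ), DifferentiableOn ℂ Fc D ∧
      (∀ w ∈ D, ‖Fc w‖ ≤ (|γ| * (ω / (1 - ω)) + |γ| + (|γ| + r + 1)) * wt κ e * Real.exp (-(κ * l1 z))) ∧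
      (∀ t ∈ Ioc (0 : ℝ) γ, closedBall (t : ℂ) r ⊆ D) ∧
      (∀ t ∈ Ioc (0 : ℝ) γ, Fc t = (polWindow F K (k + 1) (crossTermFamily F (fadingLaw ω) e k (histPrefix (Function.update h m t) k) K)
        (ContinuousLinearMap.id ℝ ℝ) (Module.Basis.singleton Unit ℝ) μ ν z : ℂ)) := by
  set A₀ : ℝ := fadingAmp ω k (histPrefix h k) with hA₀
  set q : ℝ := ω ^ (k + 1 - m) with hq
  set c₁ : ℝ := crossKernel 1 e μ ν z with hc₁
  have hq0 : 0 ≤ q := pow_nonneg hω0 _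
  have hq1 : q ≤ 1 := pow_le_one₀ hω0 hω1.le
  have hA₀le : |A₀| ≤ |γ| * (ω / (1 - ω)) := abs_fadingAmp_le hω0 hω1 (histPrefix_mem_box hh k)
  have hhm : |h m| ≤ |γ| := by
    rw [abs_of_pos (hh m).1]; exact (hh m).2.trans (le_abs_self γ)
  have hc₁le : |c₁| ≤ wt κ e * Real.exp (-(κ * l1 z)) := by
    have h1 := abs_crossKernel_le 1 e μ ν z κ
    rwa [abs_one, one_mul] at h1
  filter_upwards [polWindow_update_eventually F ω e h k m μ ν z] with K hK
  refine ⟨fun τ => (((A₀ - q * h m : ℝ) : ℂ) + (q : ℂ) * τ) * (c₁ : ℂ), ball (0 : ℂ) (|γ| + r + 1), ?_, ?_, ?_, ?_⟩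
  · -- entire
    exact ((((differentiable_const _).add ((differentiable_const _).mul differentiable_id)).mul (differentiable_const _)).differentiableOn)
  · -- the bound on the ball
    intro w hw
    rw [mem_ball_zero_iff] at hw
    have hlin : ‖((A₀ - q * h m : ℝ) : ℂ) + (q : ℂ) * w‖ ≤ |γ| * (ω / (1 - ω)) + |γ| + (|γ| + r + 1) := by
      calc ‖((A₀ - q * h m : ℝ) : ℂ) + (q : ℂ) * w‖ ≤ ‖((A₀ - q * h m : ℝ) : ℂ)‖ + ‖(q : ℂ) * w‖ := norm_add_le _ _
        _ = |A₀ - q * h m| + q * ‖w‖ := by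
            rw [Complex.norm_real, Real.norm_eq_abs, norm_mul, Complex.norm_real, Real.norm_eq_abs, abs_of_nonneg hq0]
        _ ≤ (|A₀| + q * |h m|) + q * (|γ| + r + 1) := by
            gcongr
            calc |A₀ - q * h m| ≤ |A₀| + |q * h m| := abs_sub _ _
              _ = |A₀| + q * |h m| := by rw [abs_mul, abs_of_nonneg hq0]
        _ ≤ (|γ| * (ω / (1 - ω)) + 1 * |γ|) + 1 * (|γ| + r + 1) := by
            gcongr
        _ = |γ| * (ω / (1 - ω)) + |γ| + (|γ| + r + 1) := by ring
    have hnn : 0 ≤ |γ| * (ω / (1 - ω)) + |γ| + (|γ| + r + 1) := by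
      have : 0 < 1 - ω := by linarith
      positivity
    rw [norm_mul, Complex.norm_real, Real.norm_eq_abs]
    calc ‖((A₀ - q * h m : ℝ) : ℂ) + (q : ℂ) * w‖ * |c₁| ≤ (|γ| * (ω / (1 - ω)) + |γ| + (|γ| + r + 1)) * (wt κ e * Real.exp (-(κ * l1 z))) :=
          mul_le_mul hlin hc₁le (abs_nonneg _) hnn
      _ = (|γ| * (ω / (1 - ω)) + |γ| + (|γ| + r + 1)) * wt κ e * Real.exp (-(κ * l1 z)) := by ring
  · -- the closed `r`-discs about the window lie in the ball
    intro t ht w hw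
    rw [mem_closedBall, dist_eq_norm] at hw
    rw [mem_ball_zero_iff]
    have ht' : ‖(t : ℂ)‖ ≤ |γ| := by
      rw [Complex.norm_real, Real.norm_eq_abs, abs_of_pos ht.1]; exact ht.2.trans (le_abs_self γ)
    calc ‖w‖ = ‖(w - t) + t‖ := by rw [sub_add_cancel]
      _ ≤ ‖w - (t : ℂ)‖ + ‖(t : ℂ)‖ := norm_add_le _ _
      _ ≤ r + |γ| := add_le_add hw ht'
      _ < |γ| + r + 1 := by linarith
  · -- agreement with the windowed kernel at real couplings
    intro t _
    rw [hK t, crossKernel_eq_mul_one, fadingAmp_histPrefix_update ω h hm t, ← hA₀, ← hq, ← hc₁]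
    push_cast
    ring

/-! ## §3 The other three binders at the model (dag-n18-w2 BY NAME + the uniform decay), and §1 of the consumer FIRES -/

/-- **UNIFORM KERNEL DECAY AT THE FADING TWO-BOND MODEL**: `DecayBound (EA …) (Window γ) (|γ|ω∕(1−ω)·wt κ e) κ` — dag-n22-w2 g5's `decayBound_EA_cross_of_bound` BY NAME
fed with dag-n18-w2 g6's amplitude bound `abs_fadingAmp_le` on the boxes. [folklore] -/
theorem decayBound_EA_fadingCross {ω : ℝ} (hω0 : 0 ≤ ω) (hω1 : ω < 1) (γ : ℝ) (e : Fin 4 → ℤ) (κ : ℝ) :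
    DecayBound (EA F (crossTermFamily F (fadingLaw ω) e) (ContinuousLinearMap.id ℝ ℝ) (Module.Basis.singleton Unit ℝ)) (Window γ)
      (|γ| * (ω / (1 - ω)) * wt κ e) κ :=
  decayBound_EA_cross_of_bound F (fun g hg k => by rw [fadingLaw_apply]; exact abs_fadingAmp_le hω0 hω1 (histPrefix_mem_box hg k)) e κ

/-- ★★★ **A6 — THE ANALYTIC KERNEL-FADING ROAD FIRES AT A NON-DEGENERATE MODEL THROUGH def-B's ACTUAL (1.20)–(1.22) MACHINERY.**  At dag-n18-w2's mixed two-bond family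
with the FADING amplitude law `crossTermFamily F (fadingLaw ω) e` (`0 < ω < 1`, read in the identity chart with the one-dimensional colour basis), on the window `]0, γ]^ℕ`
(`γ > 0`), at every rate `κ` and margin `r > 0`: ALL FOUR displayed inputs of `…KernelFadingOfStepRateTwoConstants.ne9_and_fadingMemory_EA_of_kernelStepRate_windowedHolo` hold
— node N18's kernel step rate (`kernelStepRate_fadingCross`, rate `θ = ω`), the uniform decay (§3), (1.21) existence (`polLimitsExist_cross`), the windowed coupling-holomorphy
datum (§2) — and the theorem FIRES: for every `s ∈ ]0,1[`, `NE9 (EA …) (Window γ) κ (C₉(ω^{1−s})^{k−i}) ∧ FadingMemory C₉ ω^{1−s} _`.  NON-DEGENERATE: the kernels READ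
EVERY young coupling (`not_boxwiseConstant_fadingLaw`, `sensitiveOnBoxes_fadingCross`); their TRUE moduli are `wt κ e·ω^{k−i}` (`ne9_EA_fadingCross`) — rate `ω` itself,
consistent with the road's «every rate above `θ = ω`» (`…N22KnitRoadRatesSharpTwoConstants`).  So the road's hypotheses are jointly inhabited by objects built with
`polWindow ∕ polLimit ∕ kernelA`, not only at the zero chart. [folklore] -/
theorem ne9_and_fadingMemory_EA_fadingCross {ω γ κ r s : ℝ} (hω0 : 0 < ω) (hω1 : ω < 1) (hγ : 0 < γ) (hr : 0 < r) (hs0 : 0 < s) (hs1 : s < 1)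
    (e : Fin 4 → ℤ) :
    ∃ C₉ : ℝ,
      NE9 (EA F (crossTermFamily F (fadingLaw ω) e) (ContinuousLinearMap.id ℝ ℝ) (Module.Basis.singleton Unit ℝ)) (Window γ) κ
          (fun k i => C₉ * (ω ^ (1 - s)) ^ (k - i)) ∧
        FadingMemory C₉ (ω ^ (1 - s)) (fun k i => C₉ * (ω ^ (1 - s)) ^ (k - i)) := by
  have h1ω : 0 < 1 - ω := by linarith
  have hwt : 0 ≤ wt κ e := wt_nonneg κ e
  set C₅ : ℝ := |γ| * ω * wt κ e with hC₅
  set E₀ : ℝ := |γ| * (ω / (1 - ω)) * wt κ e with hE₀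
  set B₁ : ℝ := (|γ| * (ω / (1 - ω)) + |γ| + (|γ| + r + 1)) * wt κ e with hB₁
  have hC₅0 : 0 ≤ C₅ := by positivity
  have hE₀0 : 0 < E₀ := by
    have hγ' : 0 < |γ| := abs_pos.2 hγ.ne'
    have hwt : 0 < wt κ e := wt_pos κ e
    positivity
  have hB₁0 : 0 ≤ B₁ := by positivity
  set B : ℝ := 2 * C₅ / (1 - ω) + 2 * E₀ + B₁ with hB
  have hCB : 2 * C₅ / (1 - ω) + 2 * E₀ ≤ B := by rw [hB]; linarith
  have hC₀0 : 0 ≤ 2 * C₅ / (1 - ω) + 2 * E₀ := by positivity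
  have hA : ∀ h ∈ Window γ, ∀ (k : ℕ) (μ ν : Fin 4) (z : Fin 4 → ℤ) (m : ℕ), m < k + 1 → ∀ᶠ K in atTop,
      ∃ (Fc : ℂ → ℂ) (D : Set ℂ), DifferentiableOn ℂ Fc D ∧ (∀ w ∈ D, ‖Fc w‖ ≤ B * Real.exp (-(κ * l1 z))) ∧
        (∀ t ∈ Ioc (0 : ℝ) γ, closedBall (t : ℂ) r ⊆ D) ∧
        (∀ t ∈ Ioc (0 : ℝ) γ, Fc t = (polWindow F K (k + 1) (crossTermFamily F (fadingLaw ω) e k (histPrefix (Function.update h m t) k) K)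
          (ContinuousLinearMap.id ℝ ℝ) (Module.Basis.singleton Unit ℝ) μ ν z : ℂ)) := by
    intro h hh k μ ν z m hm
    filter_upwards [windowedCouplingHolo_fadingCross F hω0.le hω1 e κ hr.le hh k μ ν z hm] with K hK
    obtain ⟨Fc, D, hFc, hbd, hdisc, hagree⟩ := hK
    refine ⟨Fc, D, hFc, fun w hw => (hbd w hw).trans ?_, hdisc, hagree⟩
    rw [← hB₁]
    exact mul_le_mul_of_nonneg_right (by rw [hB]; linarith) (Real.exp_nonneg _)
  exact ⟨_, ne9_and_fadingMemory_EA_of_kernelStepRate_windowedHolo F (crossTermFamily F (fadingLaw ω) e) (ContinuousLinearMap.id ℝ ℝ)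
    (Module.Basis.singleton Unit ℝ) hC₅0 hω0 hω1 hE₀0 hγ hr hs0 hs1 (kernelStepRate_fadingCross F hω0.le γ e κ)
    (decayBound_EA_fadingCross F hω0.le hω1 γ e κ) hCB (polLimitsExist_cross F (fadingLaw ω) e γ) hA⟩

/-- **THE MODEL IS NOT DEGENERATE AND ITS TRUE RATE IS `ω`**: the fading law is not boxwise constant on `]0, γ]` (`ω ≠ 0`, `γ > 0`), and the kernel functional satisfies NE9
with the moduli `wt κ e·ω^{k−i}` EXACTLY (dag-n18-w2 BY NAME) — the analytic road's output `ω^{1−s}` (every `s ∈ ]0,1[`) brackets it from above, as it must. [folklore] -/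
theorem fadingCross_nondegenerate_and_trueRate {ω γ : ℝ} (hω0 : 0 < ω) (hγ : 0 < γ) (e : Fin 4 → ℤ) (κ : ℝ) :
    ¬ YMDAG.N18.U3Guards.BoxwiseConstant γ (fadingLaw ω) ∧
      NE9 (EA F (crossTermFamily F (fadingLaw ω) e) (ContinuousLinearMap.id ℝ ℝ) (Module.Basis.singleton Unit ℝ)) (Window γ) κ
        (fun n i => wt κ e * ω ^ (n - i)) := by
  refine ⟨not_boxwiseConstant_fadingLaw hω0.ne' hγ, ?_⟩
  have h := ne9_EA_fadingCross F hω0.le γ e κ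
  rwa [crossLetters_moduli] at h

end YMDAG.N22.KernelFadingTwoConstants.Model

end
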